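import Summits.MatrixMultiplication.MatrixMultiplication.Theorems.LevelOneGL2Designs.Negative.SharpWallRelations

/-!
# Negative lemmas for the crux `LevelOneGL2Designs` (stmt-MatrixMultiplication-14080), part W2:
the SHARP level-one wall `dim F_1|_{GL_2(𝔽_p)} ≤ p³ + p² − 3p − 1`

Certified-compute seat (`refuter-ccert-…-14080-0`); no theorem asserts a Theses statement
positively.  The counting lemmas of the chain (walls, graded Neumann count: parts A, L and
`LieRankDesigns.Negative.Walls`) are stated against `N₁(p) = #{M : rk M ≤ 1} = p³ + p² − p`.  With
the `2p + 1` independent kernel relations of part W1: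

* `finrank_levelSubmodule_two_one_le` — `dim F_1|_G ≤ p³ + p² − 3p − 1 =: W(p)` (rank–nullity for
  the read-out map `levelMap` of part L; equality holds and is checked off-box by an exact rank
  computation for `p ≤ 7`, not needed here);
* `neumann_X_sharp`, `neumann_Z_sharp`, `wall_XZ_sharp` — the graded Neumann count and the wall with
  `W(p)` in place of `N₁(p)`;
* `min_card_le_three_at_three` — at `p = 3` every rank-1-separated triple has
  `min(|X|,|Y|,|Z|) ≤ 3` (`2t² − t ≤ 26`; with `N₁ = 33` the cap would be `4`); the certified-compute
  census exhibits a rank-1-separated `(3,3,3)` at `p = 3`, so the cap is attained: `M(3) = 3`.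
-/

set_option linter.dupNamespace false

noncomputable section

open scoped BigOperators

namespace Summit.MatrixMultiplication.MatrixMultiplication.Theorems.LevelOneGL2Designs.Negative

open Summit.MatrixMultiplication.MatrixMultiplication.Theorems.LieRankDesigns.Negative

variable {p : ℕ} [Fact p.Prime]

/-! ## The family of `2p + 1` relation tables: in the kernel and linearly independent -/

/-- The family of `2p + 1` relation tables, indexed by `Option (ZMod p) ⊕ ZMod p`. -/
def relFamily : Option (ZMod p) ⊕ ZMod p → ({M : Mat p 2 // M.rank ≤ 1} → ℂ)
  | Sum.inl i => colRel (repU i)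
  | Sum.inr x => rowRel (repE x)

/-- Every relation table lies in the kernel of `levelMap`. -/
theorem relFamily_mem_ker (i : Option (ZMod p) ⊕ ZMod p) :
    relFamily i ∈ LinearMap.ker (levelMap p 2 1) := by
  rw [LinearMap.mem_ker]
  cases i with
  | inl j => exact levelMap_colRel (repU_ne_zero j)
  | inr x => exact levelMap_rowRel (repE_ne_zero x)

/-- **The `2p + 1` relation tables are linearly independent.** -/
theorem linearIndependent_relFamily : LinearIndependent ℂ (relFamily (p := p)) := by
  classical
  rw [linearIndependent_iff']
  intro s g hsum
  have heval : ∀ M, ∑ i ∈ s, g i * relFamily i M = 0 := fun M => by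
    have := congrFun hsum M
    simpa [Finset.sum_apply, Pi.smul_apply, smul_eq_mul] using this
  -- step 1: the column coefficients vanish (evaluate at (repU j) e₁ᵀ)
  have hcol : ∀ j : Option (ZMod p), Sum.inl j ∈ s → g (Sum.inl j) = 0 := by
    intro j hj
    have h := heval (outer (repU j) ![1, 0])
    rw [Finset.sum_eq_single (Sum.inl j)] at h
    · have hval : relFamily (Sum.inl j) (outer (repU j) ![1, 0]) = 1 := by
        show colRel (repU j) (outer (repU j) ![1, 0]) = 1
        rw [colRel_repU_apply_outer j j e1_ne_zero, if_pos rfl]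
      rwa [hval, mul_one] at h
    · intro i _ hne
      cases i with
      | inl j' =>
        have hne' : j' ≠ j := fun h => hne (congrArg Sum.inl h)
        show g _ * colRel (repU j') (outer (repU j) ![1, 0]) = 0
        rw [colRel_repU_apply_outer j' j e1_ne_zero, if_neg hne', mul_zero]
      | inr x =>
        show g _ * rowRel (repE x) (outer (repU j) ![1, 0]) = 0
        rw [rowRel_repE_apply_outer_e1 x (repU_ne_zero j), mul_zero]
    · intro hnot; exact absurd hj hnot
  -- step 2: the row coefficients vanish (evaluate at e₁ (repE x)ᵀ)
  have hrow : ∀ x : ZMod p, Sum.inr x ∈ s → g (Sum.inr x) = 0 := by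
    intro x hx
    have h := heval (outer ![1, 0] (repE x))
    rw [Finset.sum_eq_single (Sum.inr x)] at h
    · have hval : relFamily (Sum.inr x) (outer ![1, 0] (repE x)) = 1 := by
        show rowRel (repE x) (outer ![1, 0] (repE x)) = 1
        rw [rowRel_repE_apply_outer x x e1_ne_zero, if_pos rfl]
      rwa [hval, mul_one] at h
    · intro i hi hne
      cases i with
      | inl j' =>
        cases j' with
        | none =>
          -- `repU none = e₁`: this coefficient is already zero by step 1
          rw [hcol none hi, zero_mul]
        | some y =>
          show g _ * colRel (repU (some y)) (outer ![1, 0] (repE x)) = 0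
          have h0 : colRel (repU (some y)) (outer (repU none) (repE x)) = 0 := by
            rw [colRel_repU_apply_outer (some y) none (repE_ne_zero x), if_neg (by simp)]
          exact (congrArg (g _ * ·) h0).trans (mul_zero _)
      | inr y =>
        have hne' : y ≠ x := fun h => hne (congrArg Sum.inr h)
        show g _ * rowRel (repE y) (outer ![1, 0] (repE x)) = 0
        rw [rowRel_repE_apply_outer y x e1_ne_zero, if_neg hne', mul_zero]
    · intro hnot; exact absurd hx hnot
  intro i hi
  cases i with
  | inl j => exact hcol j hi
  | inr x => exact hrow x hi

/-! ## The sharp dimension bound and the sharp counts -/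

/-- `2p + 1 ≤ dim ker(levelMap)`. -/
theorem two_p_add_one_le_finrank_ker :
    2 * p + 1 ≤ Module.finrank ℂ (LinearMap.ker (levelMap p 2 1)) := by
  classical
  let f : Option (ZMod p) ⊕ ZMod p → LinearMap.ker (levelMap p 2 1) :=
    fun i => ⟨relFamily i, relFamily_mem_ker i⟩
  have hf : LinearIndependent ℂ f := by
    apply LinearIndependent.of_comp (LinearMap.ker (levelMap p 2 1)).subtype
    exact linearIndependent_relFamily
  have h := hf.fintype_card_le_finrank
  rw [Fintype.card_sum, Fintype.card_option, ZMod.card] at h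
  omega

/-- **The sharp level-one wall dimension**: `dim F_1|_{GL_2(𝔽_p)} ≤ p³ + p² − 3p − 1`. -/
theorem finrank_levelSubmodule_two_one_le :
    Module.finrank ℂ (levelSubmodule p 2 1) ≤ p ^ 3 + p ^ 2 - 3 * p - 1 := by
  classical
  have hrn := LinearMap.finrank_range_add_finrank_ker (levelMap p 2 1)
  rw [Module.finrank_fintype_fun_eq_card, card_rankLE_two_one] at hrn
  have hk := two_p_add_one_le_finrank_ker (p := p)
  have hp : 2 ≤ p := (Fact.out : p.Prime).two_le
  have h3 : 3 * p + 1 ≤ p ^ 3 + p ^ 2 := by nlinarith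
  have hp1 : p ≤ p ^ 3 + p ^ 2 := by nlinarith
  show Module.finrank ℂ (LinearMap.range (levelMap p 2 1)) ≤ _
  omega

/-- **Sharp graded Neumann count, `X`-slab**: `|X||Z| + |X|(|Y| − 1) ≤ p³ + p² − 3p − 1`. -/
theorem neumann_X_sharp {X Y Z : Finset (GLm p 2)} (hsep : RankSep 1 X Y Z) {y₁ z₁ : GLm p 2}
    (hy₁ : y₁ ∈ Y) (hz₁ : z₁ ∈ Z) :
    X.card * Z.card + X.card * (Y.card - 1) ≤ p ^ 3 + p ^ 2 - 3 * p - 1 :=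
  (Summit.MatrixMultiplication.MatrixMultiplication.Theorems.LevelTwoBeatsCubes.Negative.packing_X
    (levelSubmodule p 2 1) levelSubmodule_right_inv X Y Z (sep_clause_of_rankSep hsep) hy₁ hz₁).trans
    finrank_levelSubmodule_two_one_le

/-- **Sharp graded Neumann count, `Z`-slab**: `|X||Z| + (|Y| − 1)|Z| ≤ p³ + p² − 3p − 1`. -/
theorem neumann_Z_sharp {X Y Z : Finset (GLm p 2)} (hsep : RankSep 1 X Y Z) {x₁ y₁ : GLm p 2}
    (hx₁ : x₁ ∈ X) (hy₁ : y₁ ∈ Y) :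
    X.card * Z.card + (Y.card - 1) * Z.card ≤ p ^ 3 + p ^ 2 - 3 * p - 1 :=
  (Summit.MatrixMultiplication.MatrixMultiplication.Theorems.LevelTwoBeatsCubes.Negative.packing_Z
    (levelSubmodule p 2 1) levelSubmodule_left_inv X Y Z (sep_clause_of_rankSep hsep) hx₁ hy₁).trans
    finrank_levelSubmodule_two_one_le

/-- **Sharp wall `XZ`**: `|X|·|Z| ≤ p³ + p² − 3p − 1` when `Y, Z ≠ ∅`. -/
theorem wall_XZ_sharp {X Y Z : Finset (GLm p 2)} (hsep : RankSep 1 X Y Z) (hY : Y.Nonempty)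
    (hZ : Z.Nonempty) : X.card * Z.card ≤ p ^ 3 + p ^ 2 - 3 * p - 1 := by
  obtain ⟨y₁, hy₁⟩ := hY
  obtain ⟨z₁, hz₁⟩ := hZ
  exact le_trans (Nat.le_add_right _ _) (neumann_X_sharp hsep hy₁ hz₁)

/-- **Balanced designs at `p = 3` have all three sets `≤ 3`** (`M(3) ≤ 3`; the certified-compute
census exhibits a rank-1-separated `(3,3,3)`, hence `M(3) = 3`): `2t² − t ≤ 26` forces `t ≤ 3`. -/
theorem min_card_le_three_at_three [Fact (Nat.Prime 3)] {X Y Z : Finset (GLm 3 2)}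
    (hsep : RankSep 1 X Y Z) {t : ℕ} (hX : t ≤ X.card) (hY : t ≤ Y.card) (hZ : t ≤ Z.card) :
    t ≤ 3 := by
  by_contra ht
  push Not at ht
  have hYne : Y.Nonempty := Finset.card_pos.mp (by omega)
  have hZne : Z.Nonempty := Finset.card_pos.mp (by omega)
  obtain ⟨y₁, hy₁⟩ := hYne
  obtain ⟨z₁, hz₁⟩ := hZne
  have h := neumann_X_sharp hsep hy₁ hz₁
  norm_num at h
  have h1 : 4 * 4 ≤ X.card * Z.card := Nat.mul_le_mul (by omega) (by omega)
  have h2 : 4 * 3 ≤ X.card * (Y.card - 1) := Nat.mul_le_mul (by omega) (by omega)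
  omega

end Summit.MatrixMultiplication.MatrixMultiplication.Theorems.LevelOneGL2Designs.Negative

end
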